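import Literature.NumberTheory.Rogawski1990.ArchDeltaTransferHaarForm            -- ★ (E1) p841341: (4.3.1) at `∞` in Haar currency
import Literature.NumberTheory.Automorphic.ArchEndoscopicStableSumTorus          -- ★ (3H) p841703: the `H`-side class bookkeeping (`…_univ`)
import Literature.NumberTheory.Rogawski1990.ArchEndoscopicStableClassCompactH    -- ★ (3R-H) p841644: `hZH` — compact centralisers in `H_∞` at a regular torus point
import HarnessLib

/-!
# The TORUS TRANSFER IDENTITY, pre-transport half: at a `G`-regular torus point of `H_∞` the symmetrised product orbital integral of `aH` (the currency of the descent ★ (E2))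
# equals `κ⁻¹ ·` the `G′`-side of (4.3.1) in Haar currency (Rogawski 1990 §4.3 (4.3.1), §14.3, Lemma 14.5.2 (c) p. 238)

Topic `NumberTheory/Rogawski1990`; namespace `Literature.NumberTheory.Rogawski1990`.  THEOREMS ONLY (no `def`, no instance, no notation, no axiom, no named fact, no `sorry`).
Cell `pub/hodgecm-mathlib`, ENGINE T1 (crux H413 = `stmt-HodgeConjecture-24833`); ROAD-Sd residual R3 «(S-c) central vanishing» (`stub_ScCore` of `Cruxes/H413/Lines/F0_P3a_SdArch.lean`),
STEP 3 ∕ 3Z assembly node **(β₀) «3H-univ ∘ (E1) AT AN ABSTRACT TORUS POINT»** = the pre-transport half of the pen's (β) (F0P3a-p03 (g11) census 06:22:08Z; LEAD WORDS T8-86 ∕ T8-92 (1));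
author F0P3a-p02 (g11), 2026-09-01.

WHY.  ★ (E1) `finsum_integral_comp_conj_eq_finsum_delta_mul_integral_comp_conj_of_isArchDeltaTransfer` reads (vi) at a `G`-regular `γ_H` with compact centralisers as
`Σᶠ_{c : γ_H ∼st out c} ∫_{H_∞} aH(h·out c·h⁻¹) dνH = Σᶠ_{c′} Δ′_∞(γ_H, out c′)·∫_{G′_∞} a′(g·out c′·g⁻¹) dν′`; ★ (3H) `exists_finsum_integral_comp_conj_eq_mul_sum_integral_pi_univ` rewrites
the LEFT side at the torus point `γ_H = (ψ⁻¹ t(u), δ)` as `κ · Σ_ε ∫ aH(ψ⁻¹ e⁻¹ o, δ) d(⊗_w M(univ, u, ε)_w)` with ONE `κ > 0`; and ★ (3R-H) discharges (E1)'s `hZH` binder at such points.  Hence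
`Σ_ε ∫ aH(ψ⁻¹ e⁻¹ o, δ) d(⊗ M(univ,u,ε)) = κ⁻¹ · Σᶠ_{c′} Δ′_∞(γ_H, out c′)·∫ a′(g·out c′·g⁻¹) dν′` — the LEFT side is EXACTLY the quantity ★ (E2) §2 `sum_integral_pi_erase_eq_zero_of_eventuallyEq`
multiplies by `2 sin ψ`, the RIGHT side is what the pen's (α) «class-sum congruence transport» moves to the diagonal frame where ★ (3G) `exists_flat_gSide_centralCurve_of_archSmooth` makes it flat.

WHAT IS PROVED.  **`exists_sum_integral_pi_eq_inv_mul_finsum_delta`** — under (E1)'s system binders VERBATIM (`(tH t′ t) (hd′ hd₃) (hC) (hC′G) (hCH)`, `(T ν′ νH) (mH m′) (hWH hW′)`) and (3H)'s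
frame (`α` with `hα hherm hsgn`, per-place Haar `νw`, the congruence `(Tm, ψ, hψ)`, (E2)'s literal family with `(z, S, hS : S = univ)`): ONE `κ > 0` such that for every measurable Δ-transfer pair
`(aH, a′)`, every regular `u`, every `δ`, `G`-regularity of `γ_H = (ψ⁻¹ t(u), δ)` and compact centralisers of its norm partners (`hreg`, `hZ′` — kept as binders; at B-p12's curve they are ★ 3R-G′),
`Σ_ε ∫ aH(ψ⁻¹ e⁻¹ o, δ) d(⊗ M(S,u,ε)) = κ⁻¹ · Σᶠ c′, T.Δ γ_H (out c′) · ∫ a′(g·out c′·g⁻¹) dν′`.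
HONEST LABEL: HC_CM is proved only modulo the 7 printed citations until rung 0 closes; this file is bookkeeping over ★ (E1) ∕ (3H) ∕ (3R-H) and pays nothing by itself.

## References
* [Rogawski1990] J. D. Rogawski, *Automorphic Representations of Unitary Groups in Three Variables*, Ann. of Math. Stud. 123 (1990), §4.3 (4.3.1) p. 43; §14.3 pp. 233–234; §14.5 Lemma 14.5.2 (c) p. 238.
* [BorelJacquet1979] A. Borel, H. Jacquet, *Automorphic forms and automorphic representations*, PSPM 33.1 (1979), §4.1.
-/

set_option autoImplicit false

noncomputable section

open MeasureTheory Measure NumberField NumberField.InfinitePlace NumberField.mixedEmbedding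
open Literature.MeasureTheory.Group Literature.NumberTheory.Automorphic Literature.NumberTheory.Automorphic.UnitaryGroup

namespace Literature.NumberTheory.Rogawski1990

section TorusIdentity

variable (L : Type) [Field L] [NumberField L] [IsCMField L] (H' : Matrix (Fin 3) (Fin 3) L)
  [MeasurableSpace (UnitaryGroup.arch (↥(maximalRealSubfield L)) L (IsCMField.complexConj L) 3 H')]
  [BorelSpace (UnitaryGroup.arch (↥(maximalRealSubfield L)) L (IsCMField.complexConj L) 3 H')]
  [MeasurableSpace (UnitaryGroup.arch (↥(maximalRealSubfield L)) L (IsCMField.complexConj L) 3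
    (Matrix.of fun i j : Fin 3 => if i.val + j.val + 1 = 3 then (1 : L) else 0))]
  [BorelSpace (UnitaryGroup.arch (↥(maximalRealSubfield L)) L (IsCMField.complexConj L) 3
    (Matrix.of fun i j : Fin 3 => if i.val + j.val + 1 = 3 then (1 : L) else 0))]
  [MeasurableSpace (UnitaryGroup.arch (↥(maximalRealSubfield L)) L (IsCMField.complexConj L) 2
          (Matrix.of fun i j : Fin 2 => if i.val + j.val + 1 = 2 then (1 : L) else 0) ×
        UnitaryGroup.arch (↥(maximalRealSubfield L)) L (IsCMField.complexConj L) 1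
          (Matrix.of fun i j : Fin 1 => if i.val + j.val + 1 = 1 then (1 : L) else 0))]
  [BorelSpace (UnitaryGroup.arch (↥(maximalRealSubfield L)) L (IsCMField.complexConj L) 2
          (Matrix.of fun i j : Fin 2 => if i.val + j.val + 1 = 2 then (1 : L) else 0) ×
        UnitaryGroup.arch (↥(maximalRealSubfield L)) L (IsCMField.complexConj L) 1
          (Matrix.of fun i j : Fin 1 => if i.val + j.val + 1 = 1 then (1 : L) else 0))]
  (tH : ∀ γH : UnitaryGroup.arch (↥(maximalRealSubfield L)) L (IsCMField.complexConj L) 2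
          (Matrix.of fun i j : Fin 2 => if i.val + j.val + 1 = 2 then (1 : L) else 0) ×
        UnitaryGroup.arch (↥(maximalRealSubfield L)) L (IsCMField.complexConj L) 1
          (Matrix.of fun i j : Fin 1 => if i.val + j.val + 1 = 1 then (1 : L) else 0),
    Measure (Subgroup.centralizer ({γH} : Set (UnitaryGroup.arch (↥(maximalRealSubfield L)) L (IsCMField.complexConj L) 2
          (Matrix.of fun i j : Fin 2 => if i.val + j.val + 1 = 2 then (1 : L) else 0) ×
        UnitaryGroup.arch (↥(maximalRealSubfield L)) L (IsCMField.complexConj L) 1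
          (Matrix.of fun i j : Fin 1 => if i.val + j.val + 1 = 1 then (1 : L) else 0)))))
  (t' : ∀ γ' : UnitaryGroup.arch (↥(maximalRealSubfield L)) L (IsCMField.complexConj L) 3 H',
    Measure (Subgroup.centralizer ({γ'} : Set (UnitaryGroup.arch (↥(maximalRealSubfield L)) L (IsCMField.complexConj L) 3 H'))))
  (t : ∀ γ : UnitaryGroup.arch (↥(maximalRealSubfield L)) L (IsCMField.complexConj L) 3
        (Matrix.of fun i j : Fin 3 => if i.val + j.val + 1 = 3 then (1 : L) else 0),
    Measure (Subgroup.centralizer ({γ} : Set (UnitaryGroup.arch (↥(maximalRealSubfield L)) L (IsCMField.complexConj L) 3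
        (Matrix.of fun i j : Fin 3 => if i.val + j.val + 1 = 3 then (1 : L) else 0)))))
  (hd' : H'.det ≠ 0) (hd₃ : (Matrix.of fun i j : Fin 3 => if i.val + j.val + 1 = 3 then (1 : L) else 0).det ≠ 0)
  -- (C), (C′G), (C_H) of the thirteen-conjunct system (texts of ★ (E1))
  (hC : ∀ (γ₁ γ₂ : UnitaryGroup.arch (↥(maximalRealSubfield L)) L (IsCMField.complexConj L) 3
        (Matrix.of fun i j : Fin 3 => if i.val + j.val + 1 = 3 then (1 : L) else 0))
      (h₁ : IsRegularElt (γ₁.val : GL (Fin 3) (mixedEmbedding.mixedSpace L)))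
      (hc : Corresponds (UnitaryGroup.conjMixed (↥(maximalRealSubfield L)) L (IsCMField.complexConj L))
        (UnitaryGroup.archFormOf L 3 (Matrix.of fun i j : Fin 3 => if i.val + j.val + 1 = 3 then (1 : L) else 0))
        (UnitaryGroup.archFormOf L 3 (Matrix.of fun i j : Fin 3 => if i.val + j.val + 1 = 3 then (1 : L) else 0)) γ₁ γ₂),
      Measure.map ⇑(UnitaryGroup.archStableCentralizerEquiv L hd₃ hd₃ hc h₁) (t γ₁) = t γ₂)
  (hC'G : ∀ (γ' : UnitaryGroup.arch (↥(maximalRealSubfield L)) L (IsCMField.complexConj L) 3 H')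
      (γ : UnitaryGroup.arch (↥(maximalRealSubfield L)) L (IsCMField.complexConj L) 3
        (Matrix.of fun i j : Fin 3 => if i.val + j.val + 1 = 3 then (1 : L) else 0))
      (h' : IsRegularElt (γ'.val : GL (Fin 3) (mixedEmbedding.mixedSpace L)))
      (hc : Corresponds (UnitaryGroup.conjMixed (↥(maximalRealSubfield L)) L (IsCMField.complexConj L))
        (UnitaryGroup.archFormOf L 3 H')
        (UnitaryGroup.archFormOf L 3 (Matrix.of fun i j : Fin 3 => if i.val + j.val + 1 = 3 then (1 : L) else 0)) γ' γ),
      Measure.map ⇑(UnitaryGroup.archStableCentralizerEquiv L hd' hd₃ hc h') (t' γ') = t γ)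
  (hCH : ∀ γH : UnitaryGroup.arch (↥(maximalRealSubfield L)) L (IsCMField.complexConj L) 2
          (Matrix.of fun i j : Fin 2 => if i.val + j.val + 1 = 2 then (1 : L) else 0) ×
        UnitaryGroup.arch (↥(maximalRealSubfield L)) L (IsCMField.complexConj L) 1
          (Matrix.of fun i j : Fin 1 => if i.val + j.val + 1 = 1 then (1 : L) else 0),
      IsArchGRegular L γH → Measure.map ⇑(endoEmbArchCentralizer L γH) (tH γH) = t (endoEmbArch L γH))
  -- the orbit σ-algebras on which the Weil-form families `m′`, `mH` live (binders of ★ (E1))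
  [∀ γ' : UnitaryGroup.arch (↥(maximalRealSubfield L)) L (IsCMField.complexConj L) 3 H',
    MeasurableSpace (UnitaryGroup.arch (↥(maximalRealSubfield L)) L (IsCMField.complexConj L) 3 H' ⧸
      Subgroup.centralizer ({γ'} : Set (UnitaryGroup.arch (↥(maximalRealSubfield L)) L (IsCMField.complexConj L) 3 H')))]
  [∀ γ' : UnitaryGroup.arch (↥(maximalRealSubfield L)) L (IsCMField.complexConj L) 3 H',
    BorelSpace (UnitaryGroup.arch (↥(maximalRealSubfield L)) L (IsCMField.complexConj L) 3 H' ⧸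
      Subgroup.centralizer ({γ'} : Set (UnitaryGroup.arch (↥(maximalRealSubfield L)) L (IsCMField.complexConj L) 3 H')))]
  [∀ a : (UnitaryGroup.arch (↥(maximalRealSubfield L)) L (IsCMField.complexConj L) 2
          (Matrix.of fun i j : Fin 2 => if i.val + j.val + 1 = 2 then (1 : L) else 0) ×
        UnitaryGroup.arch (↥(maximalRealSubfield L)) L (IsCMField.complexConj L) 1
          (Matrix.of fun i j : Fin 1 => if i.val + j.val + 1 = 1 then (1 : L) else 0)),
    MeasurableSpace ((UnitaryGroup.arch (↥(maximalRealSubfield L)) L (IsCMField.complexConj L) 2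
          (Matrix.of fun i j : Fin 2 => if i.val + j.val + 1 = 2 then (1 : L) else 0) ×
        UnitaryGroup.arch (↥(maximalRealSubfield L)) L (IsCMField.complexConj L) 1
          (Matrix.of fun i j : Fin 1 => if i.val + j.val + 1 = 1 then (1 : L) else 0)) ⧸
      Subgroup.centralizer ({a} : Set (UnitaryGroup.arch (↥(maximalRealSubfield L)) L (IsCMField.complexConj L) 2
          (Matrix.of fun i j : Fin 2 => if i.val + j.val + 1 = 2 then (1 : L) else 0) ×
        UnitaryGroup.arch (↥(maximalRealSubfield L)) L (IsCMField.complexConj L) 1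
          (Matrix.of fun i j : Fin 1 => if i.val + j.val + 1 = 1 then (1 : L) else 0))))]
  [∀ a : (UnitaryGroup.arch (↥(maximalRealSubfield L)) L (IsCMField.complexConj L) 2
          (Matrix.of fun i j : Fin 2 => if i.val + j.val + 1 = 2 then (1 : L) else 0) ×
        UnitaryGroup.arch (↥(maximalRealSubfield L)) L (IsCMField.complexConj L) 1
          (Matrix.of fun i j : Fin 1 => if i.val + j.val + 1 = 1 then (1 : L) else 0)),
    BorelSpace ((UnitaryGroup.arch (↥(maximalRealSubfield L)) L (IsCMField.complexConj L) 2
          (Matrix.of fun i j : Fin 2 => if i.val + j.val + 1 = 2 then (1 : L) else 0) ×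
        UnitaryGroup.arch (↥(maximalRealSubfield L)) L (IsCMField.complexConj L) 1
          (Matrix.of fun i j : Fin 1 => if i.val + j.val + 1 = 1 then (1 : L) else 0)) ⧸
      Subgroup.centralizer ({a} : Set (UnitaryGroup.arch (↥(maximalRealSubfield L)) L (IsCMField.complexConj L) 2
          (Matrix.of fun i j : Fin 2 => if i.val + j.val + 1 = 2 then (1 : L) else 0) ×
        UnitaryGroup.arch (↥(maximalRealSubfield L)) L (IsCMField.complexConj L) 1
          (Matrix.of fun i j : Fin 1 => if i.val + j.val + 1 = 1 then (1 : L) else 0))))]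

include hC hC'G hCH in
open scoped Classical in
/-- **(β₀) THE TORUS TRANSFER IDENTITY, PRE-TRANSPORT HALF.**  Frame: a thirteen-conjunct system in the letter's frame `(L, H′)` (its (W_H)(W′)(C)(C′G)(C_H) binders VERBATIM as in ★ (E1)),
the `H`-side torus frame of ★ (3H) (`α` diagonal hermitian with opposite signs at every place, the congruence `ψ : U(Φ₂)_∞ ≃ₜ* U(diag α)_∞` by `Tm`, per-place Haar `νw`, (E2)'s literal
family with the dead Dirac branch at `z`, `S = univ`).  Then ONE `κ > 0` serves every measurable Δ-transfer pair `(aH, a′)` (`IsArchDeltaTransfer L H′ T mH m′ aH a′`), every regular `u`, every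
`δ ∈ U(Φ₁)_∞` with `γ_H := (ψ⁻¹ t(u), δ)` `G`-regular whose norm partners have compact centralisers:
`Σ_{ε : W → Bool} ∫ aH(ψ⁻¹ e⁻¹ o, δ) d(⊗_w M(S, u, ε)_w)(o) = κ⁻¹ · Σᶠ c′, T.Δ γ_H (out c′) · ∫_{G′_∞} a′(g·out c′·g⁻¹) dν′(g)`
(★ (3H)-univ on the left of ★ (E1), ★ (3R-H) discharging (E1)'s `hZH`).  LEFT = ★ (E2) §2's integrand∕measures; RIGHT = the input of the pen's (α) transport.
[cite: Rogawski1990, §4.3 (4.3.1) p. 43; §14.3 pp. 233–234; §14.5 Lemma 14.5.2 (c) p. 238] [cite: BorelJacquet1979, §4.1] -/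
theorem exists_sum_integral_pi_eq_inv_mul_finsum_delta (T : ArchTransferFactor L H')
    (ν' : Measure (UnitaryGroup.arch (↥(maximalRealSubfield L)) L (IsCMField.complexConj L) 3 H'))
    (νH : Measure (UnitaryGroup.arch (↥(maximalRealSubfield L)) L (IsCMField.complexConj L) 2
            (Matrix.of fun i j : Fin 2 => if i.val + j.val + 1 = 2 then (1 : L) else 0) ×
          UnitaryGroup.arch (↥(maximalRealSubfield L)) L (IsCMField.complexConj L) 1
            (Matrix.of fun i j : Fin 1 => if i.val + j.val + 1 = 1 then (1 : L) else 0)))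
    [ν'.IsHaarMeasure] [ν'.IsMulRightInvariant] [νH.IsHaarMeasure] [νH.IsMulRightInvariant]
    (mH : OrbitalMeasureFamily (UnitaryGroup.arch (↥(maximalRealSubfield L)) L (IsCMField.complexConj L) 2
            (Matrix.of fun i j : Fin 2 => if i.val + j.val + 1 = 2 then (1 : L) else 0) ×
          UnitaryGroup.arch (↥(maximalRealSubfield L)) L (IsCMField.complexConj L) 1
            (Matrix.of fun i j : Fin 1 => if i.val + j.val + 1 = 1 then (1 : L) else 0)))
    (m' : OrbitalMeasureFamily (UnitaryGroup.arch (↥(maximalRealSubfield L)) L (IsCMField.complexConj L) 3 H'))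
    (hWH : mH.IsQuotientOf (IsArchGRegular L) νH tH)
    (hW' : m'.IsQuotientOf (fun γ => IsRegularElt (γ.val : GL (Fin 3) (mixedEmbedding.mixedSpace L))) ν' t')
    -- the `H`-side torus frame of ★ (3H)
    (α : Fin 2 → L) (hα : ∀ i, α i ≠ 0) (hherm : ∀ i, (IsCMField.complexConj L (α i) : L) = α i)
    (hsgn : ∀ w : {w : InfinitePlace L // IsComplex w}, (w.1.embedding (α 0)).re * (w.1.embedding (α 1)).re < 0)
    [∀ w : {w : InfinitePlace L // IsComplex w}, MeasurableSpace (archLocal L 2 (Matrix.diagonal α) w)]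
    [∀ w : {w : InfinitePlace L // IsComplex w}, BorelSpace (archLocal L 2 (Matrix.diagonal α) w)]
    (νw : ∀ w : {w : InfinitePlace L // IsComplex w}, Measure (archLocal L 2 (Matrix.diagonal α) w)) [∀ w, (νw w).IsHaarMeasure]
    (Tm : GL (Fin 2) (mixedSpace L))
    (ψ : UnitaryGroup.arch (↥(maximalRealSubfield L)) L (IsCMField.complexConj L) 2 (Matrix.of fun i j : Fin 2 => if i.val + j.val + 1 = 2 then (1 : L) else 0) ≃ₜ*
      UnitaryGroup.arch (↥(maximalRealSubfield L)) L (IsCMField.complexConj L) 2 (Matrix.diagonal α))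
    (hψ : ∀ x, ((ψ x : UnitaryGroup.arch (↥(maximalRealSubfield L)) L (IsCMField.complexConj L) 2 (Matrix.diagonal α)) : GL (Fin 2) (mixedSpace L)) =
      Tm * (x : GL (Fin 2) (mixedSpace L)) * Tm⁻¹)
    (z : {w : InfinitePlace L // IsComplex w} → Circle) (S : Finset {w : InfinitePlace L // IsComplex w}) (hS : S = Finset.univ) :
    ∃ κ : ℝ, 0 < κ ∧
      ∀ (aH : (UnitaryGroup.arch (↥(maximalRealSubfield L)) L (IsCMField.complexConj L) 2 (Matrix.of fun i j : Fin 2 => if i.val + j.val + 1 = 2 then (1 : L) else 0) ×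
          UnitaryGroup.arch (↥(maximalRealSubfield L)) L (IsCMField.complexConj L) 1 (Matrix.of fun i j : Fin 1 => if i.val + j.val + 1 = 1 then (1 : L) else 0)) → ℂ)
        (a' : UnitaryGroup.arch (↥(maximalRealSubfield L)) L (IsCMField.complexConj L) 3 H' → ℂ),
        Measurable aH → Measurable a' → IsArchDeltaTransfer L H' T mH m' aH a' →
      ∀ (u : {w : InfinitePlace L // IsComplex w} → Fin 2 → Circle), (∀ w, u w 0 ≠ u w 1) →
      ∀ δ : UnitaryGroup.arch (↥(maximalRealSubfield L)) L (IsCMField.complexConj L) 1 (Matrix.of fun i j : Fin 1 => if i.val + j.val + 1 = 1 then (1 : L) else 0),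
        IsArchGRegular L (ψ.symm (archDiagTorus L 2 α u), δ) →
        (∀ γ', IsArchNormPair L H' (ψ.symm (archDiagTorus L 2 α u), δ) γ' →
          CompactSpace (Subgroup.centralizer ({γ'} : Set (UnitaryGroup.arch (↥(maximalRealSubfield L)) L (IsCMField.complexConj L) 3 H')))) →
        ∑ ε : {w : InfinitePlace L // IsComplex w} → Bool,
            ∫ o, aH (ψ.symm ((archPiEquivCM 2 L (Matrix.diagonal α)).symm o), δ)
              ∂(Measure.pi (fun w : {w : InfinitePlace L // IsComplex w} =>
                if w ∈ S then (νw w).map (fun g : archLocal L 2 (Matrix.diagonal α) w =>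
                  g * ⟨circleDiagonal 2 (if ε w then u w ∘ ⇑(Equiv.swap (0 : Fin 2) 1) else u w), circleDiagonal_mem_archLocal_diagonal L 2 α w _⟩ * g⁻¹)
                else Measure.dirac (⟨circleDiagonal 2 ![z w, z w], circleDiagonal_mem_archLocal_diagonal L 2 α w _⟩ : archLocal L 2 (Matrix.diagonal α) w))) =
          ((κ⁻¹ : ℝ) : ℂ) * ∑ᶠ c' : ConjClasses (UnitaryGroup.arch (↥(maximalRealSubfield L)) L (IsCMField.complexConj L) 3 H'),
            T.Δ (ψ.symm (archDiagTorus L 2 α u), δ) (Quotient.out c') * ∫ g, a' (g * Quotient.out c' * g⁻¹) ∂ν' := by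
  obtain ⟨κ, hκ, h3H⟩ := exists_finsum_integral_comp_conj_eq_mul_sum_integral_pi_univ L α hα hherm hsgn νH νw Tm ψ hψ z S hS
  refine ⟨κ, hκ, fun aH a' haH ha' hδ u hu δ hreg hZ' => ?_⟩
  -- (E1)'s `hZH` at the torus point: ★ (3R-H)
  have hZH : ∀ a, IsArchStablyConjH L (ψ.symm (archDiagTorus L 2 α u), δ) a →
      CompactSpace (Subgroup.centralizer ({a} : Set (UnitaryGroup.arch (↥(maximalRealSubfield L)) L (IsCMField.complexConj L) 2
          (Matrix.of fun i j : Fin 2 => if i.val + j.val + 1 = 2 then (1 : L) else 0) ×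
        UnitaryGroup.arch (↥(maximalRealSubfield L)) L (IsCMField.complexConj L) 1
          (Matrix.of fun i j : Fin 1 => if i.val + j.val + 1 = 1 then (1 : L) else 0)))) :=
    fun a ha => compactSpace_centralizer_of_isArchStablyConjH_of_archCongr_eq_archDiagTorus L Tm ψ hψ hα hherm
      (x := (ψ.symm (archDiagTorus L 2 α u), δ)) (ContinuousMulEquiv.apply_symm_apply ψ _)
      (fun w => injective_of_apply_zero_ne_apply_one _ (hu w)) a ha
  -- (E1) at the torus point, and (3H)-univ on its left side
  have hE1 := finsum_integral_comp_conj_eq_finsum_delta_mul_integral_comp_conj_of_isArchDeltaTransfer L H' tH t' t hd' hd₃ hC hC'G hCH T ν' νH mH m' hWH hW'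
    aH a' haH ha' hδ (ψ.symm (archDiagTorus L 2 α u), δ) hreg hZH hZ'
  have h := h3H aH haH u hu δ
  rw [hE1] at h
  -- `finsum_G′ = κ • LHS` ⇒ `LHS = κ⁻¹ • finsum_G′`
  have hκ0 : (κ : ℂ) ≠ 0 := Complex.ofReal_ne_zero.2 hκ.ne'
  rw [h, ← mul_assoc, Complex.ofReal_inv, inv_mul_cancel₀ hκ0, one_mul]

end TorusIdentity

end Literature.NumberTheory.Rogawski1990

end
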